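import Summits.HodgeConjecture.HodgeConjecture.Theorems.NoetherLefschetzOneUpSummitGrantedFourfoldsSketchSector
import Summits.HodgeConjecture.HodgeConjecture.Theorems.NoetherLefschetzOneUpSummitGrantedFourfoldsStubOneSidedRung
import HarnessLib

/-!
# Crux `SummitGrantedFourfolds` (stmt-HodgeConjecture-14600), line `Sketch`: the crux is REDUCED to its one
# open stub — the one-sided supply on the heart (helper, `--supports`)

With the transfer `Theorems.stub_oneSidedRung` landed (p153934) and the composition
`Theorems.summitGrantedFourfolds_of_transfer_of_supply` landed (p154055), the crux
`SummitGrantedFourfolds` (`≡ HC(4;2,2) → HodgeConjecture`) of route `NoetherLefschetzOneUp` follows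
from the single registered open stub `stub_oneSidedSupply` of line `Sketch`
(`Cruxes/SummitGrantedFourfolds/Lines/Sketch.lean`): for every Gysin / cycle-class formalism with
Hodge-compatible Gysin morphisms, every `q ≥ 3`, every smooth projective complex `2q`-fold `X` whose
`CH₀` is not degenerate, granted the Hodge conjecture in dimensions `< 2q`, every rational
`(q,q)`-class `c` carries a one-sided Hodge-fixing pair `k • c = [Z']^* c + [Z'']^* c` (`k > 0`,
`Z' ⊂ T × X`, `Z'' ⊂ X × W`, `T, W ⊊ X` closed). This file records that implication as a theorem
(`summitGrantedFourfolds_of_oneSidedSupply`, registered sub-goal), sorry-free, no named fact.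

## References

* [VoisinHodgeII2003] C. Voisin, Hodge Theory and Complex Algebraic Geometry II, Prop. 10.26.
* [KerrPearlstein2011] M. Kerr, G. Pearlstein, §3.1.
-/

-- `Summit.HodgeConjecture.HodgeConjecture.Theorems` is the mandated namespace (single-problem summit),
-- flagged by `linter.dupNamespace`; the lakefile turns the linter off tree-wide, restated here.
set_option linter.dupNamespace false

noncomputable section

namespace Summit.HodgeConjecture.HodgeConjecture.Theorems

/-- **The crux from the one-sided supply on the heart ALONE** (line `Sketch`: its transfer stub and
its composition are theorems of the tree, `stub_oneSidedRung` / `summitGrantedFourfolds_of_transfer_of_supply`):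
if every rational `(q,q)`-class on every CH₀-non-degenerate smooth projective `2q`-fold, `q ≥ 3`,
admits a one-sided Hodge-fixing pair (granted HC below dimension `2q`, over any Hodge-compatible
Gysin formalism), then `HC(4;2,2) → HodgeConjecture`. [cite: VoisinHodgeII2003, Prop. 10.26]
[cite: KerrPearlstein2011, §3.1] -/
theorem summitGrantedFourfolds_of_oneSidedSupply :
    (∀ (G : Literature.AlgebraicGeometry.HodgeTheory.GysinFormalism), G.IsGysinHodgeCompatible → ∀ ⦃q : ℕ⦄ ⦃X : Literature.AlgebraicGeometry.Motives.SchemeOver ℂ⦄ (_ : 3 ≤ q) (hX : Literature.AlgebraicGeometry.Motives.IsSmoothProjective (2 * q) X), Summit.HodgeConjecture.HodgeConjecture.Theorems.RegimeSplit.HodgeBelowDim (2 * q) → ¬ Summit.HodgeConjecture.HodgeConjecture.Theorems.RegimeSplit.ChowZeroDegenerate X → ∀ c : Literature.AlgebraicGeometry.HodgeTheory.complexBetti X (2 * q), Literature.AlgebraicGeometry.HodgeTheory.IsRationalClass c → Literature.AlgebraicGeometry.HodgeTheory.IsOfHodgeType (2 * q) X (2 * q) q q c → ∃ (k : ℕ)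 (T W : Set X.left) (Z' Z'' : ↥(Literature.AlgebraicGeometry.Motives.cyclesOfDim (CategoryTheory.MonoidalCategoryStruct.tensorObj X X).left (2 * q))), 0 < k ∧ IsClosed T ∧ T ≠ Set.univ ∧ IsClosed W ∧ W ≠ Set.univ ∧ (∀ z, (Z' : AlgebraicGeometry.AlgebraicCycle (CategoryTheory.MonoidalCategoryStruct.tensorObj X X).left ℤ) z ≠ 0 → (CategoryTheory.SemiCartesianMonoidalCategory.fst X X).left.base z ∈ T) ∧ (∀ z, (Z'' : AlgebraicGeometry.AlgebraicCycle (CategoryTheory.MonoidalCategoryStruct.tensorObj X X).left ℤ) z ≠ 0 → (CategoryTheory.SemiCartesianMonoidalCategory.snd X X).left.base z ∈ W) ∧ (k : ℂ) • c = G.corrAct hX hX (2 * q) Z' c + G.corrAct hX hX (2 * q) Z'' c) → Summit.HodgeConjecture.HodgeConjecture.Theses.NoetherLefschetzOneUp.SummitGrantedFourfolds :=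
  fun hS ↦ summitGrantedFourfolds_of_transfer_of_supply stub_oneSidedRung hS

end Summit.HodgeConjecture.HodgeConjecture.Theorems

end
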